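import Literature.NumberTheory.Transcendental.KaehlerHodge
import HarnessLib

/-!
# `Δ_d` preserves types on a Kähler manifold: corrected statements (holomorphic atlas as a binder)

`Literature/NumberTheory/Transcendental/KaehlerHodge.lean` renders Voisin's Corollary 6.9
(Hodge Theory and Complex Algebraic Geometry I, §6.1.2: on a Kähler manifold `X`, "if
`α ∈ A^k(X)` is harmonic, its components `α^{p,q}` are harmonic" — from Thm. 6.7
`Δ_∂ = Δ_∂̄ = ½ Δ_d` and Cor. 6.8 "`Δ_d` is bihomogeneous") as the two named facts
`Literature.NumberTheory.Transcendental.typeComponent_mem_charmonicForms g o` (complex forms) and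
`Literature.NumberTheory.Transcendental.typeComponent_mem_harmonicForms g o` (real forms: the
real and imaginary parts of `(β ⊗ 1)^{p,q}` of a real harmonic `β` are harmonic). Both
`def … : Prop` are M5 mechanical rewrites of sorried theorems and abstract only the section
variables their bodies use: their binders are `E, M, k, m, [FiniteDimensional ℂ E], n,
[Fact (finrank ℝ E = n)], [IsManifold 𝓘(ℝ, E) ∞ M], g, o` — the **holomorphic atlas**
`[IsManifold 𝓘(ℂ, E) ω M]` of the section is *not* among them. As elaborated they speak about
any real `C^∞` manifold charted on `E`, where the "complex structure" `J_x = i •` of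
`TangentSpace 𝓘(ℝ, E) x = E` is read in the preferred chart `chartAt x` of a merely smooth
atlas and the type projections of smooth forms need not be continuous; in that generality both
are **false**: `Literature/NumberTheory/Transcendental/KaehlerHodgeTypeCounterexample.lean`
(`not_forall_typeComponent_mem_harmonicForms`, `not_forall_typeComponent_mem_charmonicForms`:
`ℂ` with the atlas `{id, conj}`, `conj` preferred at the origin, the flat metric — smooth and
Kähler in the sense of `IsKaehler` — and the harmonic `1`-form `dx`, whose `(1,0)`-component
`½ dz` has the non-smooth imaginary part `½ dy`).

This file records the **corrected statements**
`typeComponent_mem_charmonicForms_of_isManifold_complex` and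
`typeComponent_mem_harmonicForms_of_isManifold_complex`, with the holomorphic atlas as an
explicit instance binder of the `def` (the pattern of
`Literature.NumberTheory.Transcendental.finite_dolbeaultHarmonicForms_of_isManifold` and
`cHodgeLaplacian_eq_two_smul_dolbeaultLaplacian_of_isManifold_complex`) and the bodies unchanged,
the definitional `iff`s with the old `Prop`s at a complex manifold, and the **proved reduction**
of the real statement to the complex one (`typeComponent_mem_harmonicForms_of_isManifold_complex_of`:
`β ⊗ 1` is `Δ_d`-harmonic iff `β` is, and `(β ⊗ 1)^{p,q}` is `Δ_d`-harmonic iff its real and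
imaginary parts are, by the complexification fact `mem_charmonicForms_iff_re_im`). With a
holomorphic atlas every ingredient (`typeComponent`, the `ℂ`-linear Hodge star of the smooth
Kähler metric `g`, `cHodgeLaplacian`) is the honest object and the statements are Voisin's
corollary; the proof is Thm. 6.7, i.e. the Kähler identities `[Λ, ∂̄] = -i∂*`, `[Λ, ∂] = i∂̄*`
(Prop. 6.5, via Lemma 6.6 and the osculation of a Kähler metric to the flat one, Prop. 3.14),
not yet in `Literature/` — they stay named facts here. The old defs have no dependents.

## References

* C. Voisin, *Hodge Theory and Complex Algebraic Geometry I*, Cambridge Studies in Advanced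
  Mathematics 76 (2002), §6.1.1 (Prop. 6.5, Lemma 6.6), §6.1.2 (Thm. 6.7, Cor. 6.8, Cor. 6.9,
  Cor. 6.10), §3.1.3 (Prop. 3.14).
* D. Huybrechts, *Complex Geometry* (2005), Prop. 3.1.12 (iii), Cor. 3.2.12.
-/

noncomputable section

open scoped Manifold ContDiff Topology
open Bundle Module

namespace Literature.NumberTheory.Transcendental

variable {E : Type*} [NormedAddCommGroup E] [NormedSpace ℂ E]
  {M : Type*} [TopologicalSpace M] [ChartedSpace E M] {k m : ℕ}
  [FiniteDimensional ℂ E] {n : ℕ} [Fact (finrank ℝ E = n)] [IsManifold 𝓘(ℝ, E) ∞ M]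
  (g : ContMDiffRiemannianMetric 𝓘(ℝ, E) ∞ E (fun x : M ↦ TangentSpace 𝓘(ℝ, E) x))
  (o : (x : M) → Orientation ℝ (TangentSpace 𝓘(ℝ, E) x) (Fin n))

/-- **`Δ_d` preserves types on a Kähler manifold — corrected statement** (Voisin (2002), §6.1.2,
Cor. 6.8: "If `X` is Kähler, the Laplacian `Δ_d` is bihomogeneous, `Δ_d(A^{p,q}(X)) ⊂ A^{p,q}(X)`"
and Cor. 6.9: "If `α ∈ A^k(X)` is harmonic, its components `α^{p,q}` are harmonic"). For a
**complex** manifold `M` (holomorphic atlas `[IsManifold 𝓘(ℂ, E) ω M]`, an explicit binder of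
this def), a smooth Riemannian metric `g` on the real tangent bundle which is Kähler
(`IsKaehler`), an orientation family `o` with smooth volume form (`ho`; `Δ_d` does not depend on
`o`) and degrees `h : k + m = n`: the `(p,q)`-component of a complex `k`-form in
`charmonicForms o h` (the `ℂ`-span of the smooth `Δ_d`-harmonic forms) lies in `charmonicForms o h`.
No compactness is needed (Thm. 6.7 is local). This corrects
`Literature.NumberTheory.Transcendental.typeComponent_mem_charmonicForms`, whose `def` does not
abstract the unused section instance `[IsManifold 𝓘(ℂ, E) ω M]` and is false for general smooth
real atlases (module docstring; `KaehlerHodgeTypeCounterexample.lean`); same body otherwise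
(`typeComponent_mem_charmonicForms_of_isManifold_complex_iff`). Not proved here: the proof is
Voisin's Thm. 6.7 (Kähler identities, Prop. 6.5), absent from the tree.
[cite: Voisin2002, §6.1.2 Cor. 6.8–6.9] -/
def typeComponent_mem_charmonicForms_of_isManifold_complex [IsManifold 𝓘(ℂ, E) ω M] : Prop :=
  ∀ (hg : g.toRiemannianMetric.IsKaehler) (h : k + m = n) (p q : ℕ)
    {α : Literature.Geometry.Kaehler.MForm 𝓘(ℝ, E) M ℂ k},
    letI : RiemannianBundle (fun x : M ↦ TangentSpace 𝓘(ℝ, E) x) := ⟨g.toRiemannianMetric⟩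
    Literature.Geometry.Kaehler.IsSmoothForm (Literature.Geometry.Kaehler.riemannianVolumeForm o) →
      α ∈ charmonicForms o h → α.typeComponent p q ∈ charmonicForms o h

/-- At a complex manifold the corrected fact *is* the old `Prop`
`typeComponent_mem_charmonicForms g o` (same body). [folklore] -/
theorem typeComponent_mem_charmonicForms_of_isManifold_complex_iff [IsManifold 𝓘(ℂ, E) ω M] :
    typeComponent_mem_charmonicForms_of_isManifold_complex (k := k) (m := m) g o ↔
      typeComponent_mem_charmonicForms (k := k) (m := m) g o :=
  Iff.rfl

/-- **`Δ_d` preserves types on a Kähler manifold, real form — corrected statement**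
(Voisin (2002), §6.1.2, Cor. 6.9, applied to the complexification `β ⊗ 1` of a real form). For a
**complex** manifold `M` (holomorphic atlas `[IsManifold 𝓘(ℂ, E) ω M]`, an explicit binder of
this def), a smooth Kähler metric `g`, an orientation family `o` with smooth volume form and
degrees `h : k + m = n`: if the real `k`-form `β` lies in `harmonicForms o h` (the `ℝ`-span of
the smooth `Δ`-harmonic forms of the Riemannian manifold `(M, g)`), then the real and imaginary
parts of the `(p,q)`-component `(β ⊗ 1)^{p,q}` lie in `harmonicForms o h`. This corrects
`Literature.NumberTheory.Transcendental.typeComponent_mem_harmonicForms`, whose `def` does not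
abstract the unused section instance `[IsManifold 𝓘(ℂ, E) ω M]` and is false for general smooth
real atlases (module docstring; `KaehlerHodgeTypeCounterexample.lean`); same body otherwise
(`typeComponent_mem_harmonicForms_of_isManifold_complex_iff`). Not proved here (Thm. 6.7); it
follows from the complex statement and the complexification fact `mem_charmonicForms_iff_re_im`
(`typeComponent_mem_harmonicForms_of_isManifold_complex_of`). [cite: Voisin2002, §6.1.2 Cor. 6.9] -/
def typeComponent_mem_harmonicForms_of_isManifold_complex [IsManifold 𝓘(ℂ, E) ω M] : Prop :=
  ∀ (hg : g.toRiemannianMetric.IsKaehler) (h : k + m = n) (p q : ℕ)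
    {β : Literature.Geometry.Kaehler.MForm 𝓘(ℝ, E) M ℝ k},
    letI : RiemannianBundle (fun x : M ↦ TangentSpace 𝓘(ℝ, E) x) := ⟨g.toRiemannianMetric⟩
    Literature.Geometry.Kaehler.IsSmoothForm (Literature.Geometry.Kaehler.riemannianVolumeForm o) →
      β ∈ Literature.Geometry.Kaehler.harmonicForms o h →
      (β.ofReal.typeComponent p q).re ∈ Literature.Geometry.Kaehler.harmonicForms o h ∧
        (β.ofReal.typeComponent p q).im ∈ Literature.Geometry.Kaehler.harmonicForms o h

/-- At a complex manifold the corrected fact *is* the old `Prop`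
`typeComponent_mem_harmonicForms g o` (same body). [folklore] -/
theorem typeComponent_mem_harmonicForms_of_isManifold_complex_iff [IsManifold 𝓘(ℂ, E) ω M] :
    typeComponent_mem_harmonicForms_of_isManifold_complex (k := k) (m := m) g o ↔
      typeComponent_mem_harmonicForms (k := k) (m := m) g o :=
  Iff.rfl

/-- **The real statement from the complex one** (the step "applied to `α = β ⊗ 1`" of
Voisin (2002), Cor. 6.9 / Cor. 6.10 for real harmonic forms): given the complexification fact
`mem_charmonicForms_iff_re_im` for the metric `g` (a complex form is in `ℋᵏ_ℂ` iff its real and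
imaginary parts are in `ℋᵏ`) and the complex type-preservation statement, a real `β ∈ ℋᵏ` has
`β ⊗ 1 ∈ ℋᵏ_ℂ` (`Re (β ⊗ 1) = β`, `Im (β ⊗ 1) = 0`), hence `(β ⊗ 1)^{p,q} ∈ ℋᵏ_ℂ`, hence its
real and imaginary parts are in `ℋᵏ`. [cite: Voisin2002, §6.1.2 Cor. 6.9] -/
theorem typeComponent_mem_harmonicForms_of_isManifold_complex_of [IsManifold 𝓘(ℂ, E) ω M]
    (h₁ : letI : RiemannianBundle (fun x : M ↦ TangentSpace 𝓘(ℝ, E) x) := ⟨g.toRiemannianMetric⟩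
      mem_charmonicForms_iff_re_im (k := k) (m := m) o)
    (h₂ : typeComponent_mem_charmonicForms_of_isManifold_complex (k := k) (m := m) g o) :
    typeComponent_mem_harmonicForms_of_isManifold_complex (k := k) (m := m) g o := by
  intro hg h p q β ho hβ
  letI : RiemannianBundle (fun x : M ↦ TangentSpace 𝓘(ℝ, E) x) := ⟨g.toRiemannianMetric⟩
  have hβc : β.ofReal ∈ charmonicForms o h :=
    (h₁ ho h β.ofReal).2 ⟨by simpa using hβ, by simp⟩
  exact (h₁ ho h _).1 (h₂ hg h p q ho hβc)

end Literature.NumberTheory.Transcendental
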